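import Literature.ModelTheory.ExponentialFields.Wilkie1989Lemma3Proofs
import HarnessLib

/-!
# Wilkie 1989, §6: adjoining a new variable `xₙ₊₁` to `k[x̄]ᵉ` and to the chains of subrings

Trunk `TranscendEllArithS`, family `periods` (periods.S28): infrastructure for the leaf
`Literature.ModelTheory.ExponentialFields.Wilkie1989_expAlgebraicPoints_mem` (`Wilkie1989.lean`;
§6 of A. J. Wilkie, *On the theory of the real exponential field*, Illinois J. Math. 33 (1989),
384–408).

The proof of Theorem 2 (§6, pp. 403–405) repeatedly passes from `n` to `n + 1` variables:
"Now define `h̃ₙ, f ∈ k[x̄, xₙ₊₁]ᵉ` by `h̃ₙ = xₙ₊₁ · a₀ - 1` and `f = 1 + xₙ₊₁ · Σᵢ₌₁^{s+1} aᵢ e^{ig}`.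
Let `αₙ₊₁ = a₀(ᾱ)⁻¹` and set `M̃ = M[xₙ₊₁]` (a subring of `k[x̄, xₙ₊₁]ᵉ`). Then
`h₁, …, hₙ₋₁, h̃ₙ ∈ M̃`, `f ∈ M̃[e^g]`, `f` has degree `≤ s + 1` (in `M̃[e^g]`) and … so that `M̃` has
height `≤ j` (as a subring of `k[x̄, xₙ₊₁]ᵉ)" (p. 404), and twice more in the "de-singularizing
trick of considering `g = xₙ₊₁ · det J - 1`" (p. 405).  In the tree's set-up
(`Wilkie1989Lemma3Proofs.lean`: the ring `k[x̄]ᵉ` of term functions `RealExpModel.termFnRing f n`,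
its derivations `RealExpModel.pd`, and the chains `RealExpModel.chain f n g` of subrings
`k = M₀ ⊆ k[x₁] ⊆ ⋯ ⊆ k[x̄] = Mₙ ⊆ Mₙ[e^{gₙ}] ⊆ ⋯` with exponents `g`, whose stages `n + j` are the
subrings of height `≤ j`) this file provides, all **proved**:

* `RealExpModel.liftFn f n : k[x̄]ᵉ →+* k[x̄, xₙ₊₁]ᵉ`, `F ↦ ((x̄, xₙ₊₁) ↦ F(x̄))` (the function of
  the lifted term `RealExpModel.liftTerm`), with `∂/∂xᵢ ∘ lift = lift ∘ ∂/∂xᵢ` (`pd_castSucc_liftFn`),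
  `∂/∂xₙ₊₁ ∘ lift = 0` (`pd_last_liftFn`), its values on constants, coordinates and exponentials,
  and the gradient rows `∇(lift F)(x̄, xₙ₊₁) = (∇F(x̄), 0)` (`jrow_liftFn`);
* the lifted chain: exponents `RealExpModel.liftExp f n g` and the stage map
  `RealExpModel.liftIdx n m` (`m ↦ m` for `m ≤ n`, `m ↦ m + 1` beyond: the new variable is
  adjoined right after `xₙ`), with `lift (M_m) ⊆ M̃_{liftIdx m}` (`liftFn_mem_chain`: this is
  "`M̃ = M[xₙ₊₁]` has height `≤ j`"), admissibility of the lifted exponents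
  (`liftExp_admissible`), the generators (`liftFn_chainGen_of_le`: `lift (e^{g_m}) = e^{g̃_{m+1}}`),
  and the transport of degrees (`DegLT.liftFn`: "`f` has degree `≤ s + 1` (in `M̃[e^g]`)");
* zero sets: `RealExpModel.mem_VF_comp_liftFn`.

## References

* A. J. Wilkie, *On the theory of the real exponential field*, Illinois J. Math. 33 (1989),
  384–408: §6, pp. 403–405.
-/

noncomputable section

open FirstOrder FirstOrder.Language FirstOrder.Language.Structure
open Polynomial

namespace Literature.ModelTheory.ExponentialFields

namespace RealExpModel

variable {k K : Language.Theory.ModelType.{0, 0, 0} realExpTheory}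
  (f : k ↪[Language.orderedExpRing] K) (n : ℕ)

/-! ### The lift `k[x̄]ᵉ → k[x̄, xₙ₊₁]ᵉ` -/

/-- **Adjoining the variable `xₙ₊₁`**: the ring homomorphism `k[x̄]ᵉ → k[x̄, xₙ₊₁]ᵉ` regarding a
function of `x₁, …, xₙ` as a function of `x₁, …, xₙ₊₁` (the function of the lifted term,
Wilkie 1989, p. 404: "`h̃ₙ, f ∈ k[x̄, xₙ₊₁]ᵉ` … `M̃ = M[xₙ₊₁]` (a subring of `k[x̄, xₙ₊₁]ᵉ`)").
[cite: Wilkie1989, §6, p. 404] -/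
def liftFn : termFnRing f n →+* termFnRing f (n + 1) where
  toFun F :=
    ⟨fun x => (F : (Fin n → K) → K) (Fin.init x), liftTerm (reprTerm f n F), funext fun x => by
      conv_lhs => rw [termFn_apply, ← Fin.snoc_init_self x]
      rw [realize_liftTerm, realize_reprTerm]⟩
  map_one' := Subtype.ext (funext fun x => rfl)
  map_mul' F G := Subtype.ext (funext fun x => rfl)
  map_zero' := Subtype.ext (funext fun x => rfl)
  map_add' F G := Subtype.ext (funext fun x => rfl)

variable {f n}

/-- Values of a lifted function. [folklore] -/
@[simp] theorem coe_liftFn (F : termFnRing f n) (x : Fin (n + 1) → K) :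
    ((liftFn f n F : termFnRing f (n + 1)) : (Fin (n + 1) → K) → K) x =
      (F : (Fin n → K) → K) (Fin.init x) := rfl

/-- The lift of the function of a term is the function of the lifted term. [folklore] -/
theorem liftFn_fnOf (t : Language.orderedExpRing.Term (k ⊕ Fin n)) :
    liftFn f n (fnOf f n t) = fnOf f (n + 1) (liftTerm t) := by
  apply Subtype.ext
  funext x
  rw [coe_liftFn, coe_fnOf, coe_fnOf, termFn_apply, termFn_apply, ← Fin.snoc_init_self x,
    realize_liftTerm, Fin.init_snoc]

/-- **`∂/∂xᵢ` commutes with the lift** (`i ≤ n`). [folklore] -/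
theorem pd_castSucc_liftFn (l : Fin n) (F : termFnRing f n) :
    pd f (n + 1) (Fin.castSucc l) (liftFn f n F) = liftFn f n (pd f n l F) := by
  obtain ⟨t, rfl⟩ := exists_fnOf_eq f n F
  rw [liftFn_fnOf, pd_fnOf, pd_fnOf, liftFn_fnOf]
  apply Subtype.ext
  funext x
  rw [coe_fnOf, coe_fnOf, termFn_apply, termFn_apply, ← Fin.snoc_init_self x,
    realize_termPDeriv_castSucc_liftTerm, realize_liftTerm]

/-- **A lifted function does not depend on `xₙ₊₁`.** [folklore] -/
@[simp] theorem pd_last_liftFn (F : termFnRing f n) : pd f (n + 1) (Fin.last n) (liftFn f n F) = 0 := by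
  obtain ⟨t, rfl⟩ := exists_fnOf_eq f n F
  rw [liftFn_fnOf, pd_fnOf]
  apply Subtype.ext
  funext x
  rw [coe_fnOf, termFn_apply, realize_termPDeriv_last_liftTerm]
  rfl

/-- The gradient row of a lifted function: `(∇F(x̄), 0)`. [folklore] -/
theorem jrow_liftFn (F : termFnRing f n) (x : Fin (n + 1) → K) :
    jrow f (n + 1) (liftFn f n F) x = Fin.snoc (jrow f n F (Fin.init x)) 0 := by
  funext l
  refine Fin.lastCases ?_ (fun l => ?_) l
  · simp [jrow]
  · simp [jrow, pd_castSucc_liftFn]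

/-- Lift of a constant. [folklore] -/
@[simp] theorem liftFn_constFn (c : k) : liftFn f n (constFn f n c) = constFn f (n + 1) c :=
  Subtype.ext (funext fun _ => rfl)

/-- Lift of a coordinate function. [folklore] -/
@[simp] theorem liftFn_coordFn (i : Fin n) :
    liftFn f n (coordFn f n i) = coordFn f (n + 1) (Fin.castSucc i) :=
  Subtype.ext (funext fun _ => rfl)

/-- Lift of an exponential. [folklore] -/
@[simp] theorem liftFn_expFn (F : termFnRing f n) :
    liftFn f n (expFn f n F) = expFn f (n + 1) (liftFn f n F) :=
  Subtype.ext (funext fun _ => rfl)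

/-- Zero sets of lifted systems. [folklore] -/
theorem mem_VF_comp_liftFn {p : ℕ} (F : Fin p → termFnRing f n) (x : Fin (n + 1) → K) :
    x ∈ VF f (n + 1) (fun r => liftFn f n (F r)) ↔ Fin.init x ∈ VF f n F := by
  simp [VF]

/-! ### The lifted chain -/

section Chain

variable (f n)

/-- The exponents of the lifted chain: the exponential adjoined at stage `m + 1 > n + 1` of
`k[x̄, xₙ₊₁]ᵉ` is the lift of the one adjoined at stage `m` of `k[x̄]ᵉ` (stages `≤ n + 1` adjoin
coordinates and ignore the exponent). [cite: Wilkie1989, §6, p. 404] -/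
def liftExp (g : ℕ → termFnRing f n) : ℕ → termFnRing f (n + 1) :=
  fun m => if m ≤ n then 0 else liftFn f n (g (m - 1))

/-- The stage of `k[x̄, xₙ₊₁]ᵉ` corresponding to stage `m` of `k[x̄]ᵉ`: the new variable is adjoined
right after `xₙ`. [cite: Wilkie1989, §6, p. 404] -/
def liftIdx (n m : ℕ) : ℕ := if m ≤ n then m else m + 1

variable {f n}

/-- `liftIdx` on polynomial stages. [folklore] -/
theorem liftIdx_of_le {m : ℕ} (h : m ≤ n) : liftIdx n m = m := if_pos h

/-- `liftIdx` beyond the polynomial stages. [folklore] -/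
theorem liftIdx_of_lt {m : ℕ} (h : n < m) : liftIdx n m = m + 1 := if_neg (not_le.2 h)

/-- `liftIdx` is at most the successor. [folklore] -/
theorem liftIdx_le_succ (m : ℕ) : liftIdx n m ≤ m + 1 := by
  unfold liftIdx; split_ifs <;> omega

/-- `liftIdx` is monotone. [folklore] -/
theorem liftIdx_mono : Monotone (liftIdx n) := by
  intro a b hab
  unfold liftIdx; split_ifs <;> omega

/-- The exponents of the lifted chain beyond the polynomial stages. [folklore] -/
theorem liftExp_of_lt (g : ℕ → termFnRing f n) {m : ℕ} (h : n < m) :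
    liftExp f n g m = liftFn f n (g (m - 1)) := if_neg (not_le.2 h)

/-- **The lift of the generator `e^{g_m}` (`m ≥ n`) is the generator `e^{g̃_{m+1}}` of the lifted
chain.** [cite: Wilkie1989, §6, p. 404] -/
theorem liftFn_chainGen_of_le (g : ℕ → termFnRing f n) {m : ℕ} (hm : n ≤ m) :
    liftFn f n (chainGen f n g m) = chainGen f (n + 1) (liftExp f n g) (m + 1) := by
  rw [chainGen_of_le f n g hm, chainGen_of_le f (n + 1) (liftExp f n g) (by omega), liftFn_expFn,
    liftExp_of_lt g (by omega)]
  rfl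

/-- The lift of the generator `x_{m+1}` (`m < n`) is the generator `x_{m+1}` of the lifted chain.
[folklore] -/
theorem liftFn_chainGen_of_lt (g : ℕ → termFnRing f n) {m : ℕ} (hm : m < n) :
    liftFn f n (chainGen f n g m) = chainGen f (n + 1) (liftExp f n g) m := by
  rw [chainGen_of_lt f n g hm, chainGen_of_lt f (n + 1) (liftExp f n g) (by omega), liftFn_coordFn]
  rfl

/-- **The lift maps stage `m` into stage `liftIdx m`** ("`M̃ = M[xₙ₊₁]` … has height `≤ j` (as a
subring of `k[x̄, xₙ₊₁]ᵉ)`", Wilkie 1989, p. 404). [cite: Wilkie1989, §6, p. 404] -/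
theorem liftFn_mem_chain (g : ℕ → termFnRing f n) {m : ℕ} {F : termFnRing f n}
    (hF : F ∈ chain f n g m) : liftFn f n F ∈ chain f (n + 1) (liftExp f n g) (liftIdx n m) := by
  induction m generalizing F with
  | zero =>
    obtain ⟨c, rfl⟩ := (mem_chain_zero f n g).1 hF
    rw [liftFn_constFn, liftIdx_of_le (Nat.zero_le n)]
    exact constFn_mem_chain f (n + 1) (liftExp f n g) c 0
  | succ m ih =>
    obtain ⟨P, rfl⟩ := (mem_chain_succ f n g).1 hF
    rw [Polynomial.eval_map, Polynomial.hom_eval₂, Polynomial.eval₂_eq_sum, Polynomial.sum_def]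
    have hcoeff : ∀ e, liftFn f n ((P.coeff e : chain f n g m) : termFnRing f n) ∈
        chain f (n + 1) (liftExp f n g) (m + 1) := fun e =>
      chain_mono f (n + 1) _ ((liftIdx_le_succ m)) (ih (P.coeff e).2)
    rcases lt_or_ge m n with hmn | hmn
    · -- a polynomial stage: `liftIdx (m + 1) = m + 1`
      rw [liftIdx_of_le (Nat.succ_le_of_lt hmn), liftFn_chainGen_of_lt g hmn]
      refine Subring.sum_mem _ fun e _ => Subring.mul_mem _ (hcoeff e) (Subring.pow_mem _ ?_ _)
      exact chainGen_mem f (n + 1) (liftExp f n g) m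
    · -- an exponential stage: `liftIdx (m + 1) = m + 2`
      rw [liftIdx_of_lt (Nat.lt_succ_of_le hmn), liftFn_chainGen_of_le g hmn]
      refine Subring.sum_mem _ fun e _ => Subring.mul_mem _ ?_ (Subring.pow_mem _ ?_ _)
      · exact chain_le_succ f (n + 1) _ (m + 1) (hcoeff e)
      · exact chainGen_mem f (n + 1) (liftExp f n g) (m + 1)

/-- **The lifted exponents are admissible** (`g̃ᵢ ∈ M̃ᵢ` for `i ≥ n + 1`). [cite: Wilkie1989, §6, p. 404] -/
theorem liftExp_admissible {g : ℕ → termFnRing f n} (hg : ∀ i, n ≤ i → g i ∈ chain f n g i) :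
    ∀ i, n + 1 ≤ i → liftExp f n g i ∈ chain f (n + 1) (liftExp f n g) i := by
  intro i hi
  rw [liftExp_of_lt g (by omega)]
  have h1 := liftFn_mem_chain g (hg (i - 1) (by omega))
  refine chain_mono f (n + 1) _ ?_ h1
  have := liftIdx_le_succ (n := n) (i - 1)
  omega

/-- The lift restricted to a stage of the chain, into the corresponding stage of the lifted
chain (as a ring homomorphism). [folklore] -/
def liftFnStage (g : ℕ → termFnRing f n) (m m' : ℕ) (h : liftIdx n m ≤ m') :
    chain f n g m →+* chain f (n + 1) (liftExp f n g) m' :=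
  ((Subring.inclusion (chain_mono f (n + 1) _ h)).comp
    ((liftFn f n).restrict (chain f n g m) (chain f (n + 1) (liftExp f n g) (liftIdx n m))
      fun _ hF => liftFn_mem_chain g hF))

/-- Values of `liftFnStage`. [folklore] -/
@[simp] theorem coe_liftFnStage (g : ℕ → termFnRing f n) (m m' : ℕ) (h : liftIdx n m ≤ m')
    (F : chain f n g m) : ((liftFnStage g m m' h F : chain f (n + 1) (liftExp f n g) m') :
      termFnRing f (n + 1)) = liftFn f n F := rfl

/-- **Lifting a polynomial expression**: `lift (P(Y)) = P̃(lift Y)` where `P̃` has the lifted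
coefficients. [folklore] -/
theorem liftFn_eval_map (g : ℕ → termFnRing f n) (m m' : ℕ) (h : liftIdx n m ≤ m')
    (P : Polynomial (chain f n g m)) (Y : termFnRing f n) :
    liftFn f n ((P.map (chain f n g m).subtype).eval Y) =
      (((P.map (liftFnStage g m m' h)).map (chain f (n + 1) (liftExp f n g) m').subtype).eval
        (liftFn f n Y)) := by
  rw [Polynomial.eval_map, Polynomial.hom_eval₂, Polynomial.map_map, Polynomial.eval_map]
  congr 1

/-- **Degrees are preserved by the lift** at the exponential stages ("`f` has degree `≤ s + 1`
(in `M̃[e^g]`)", Wilkie 1989, p. 404): an element of degree `< s` over `M_m` in `e^{g_m}`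
(`m ≥ n`) lifts to an element of degree `< s` over `M̃_{m+1}` in `e^{g̃_{m+1}}`. [cite: Wilkie1989, §6, p. 404] -/
theorem DegLT.liftFn {g : ℕ → termFnRing f n} {m : ℕ} (hm : n ≤ m) {F : termFnRing f n} {s : ℕ}
    (hF : DegLT (chain f n g m) (chainGen f n g m) F s) :
    DegLT (chain f (n + 1) (liftExp f n g) (m + 1)) (chainGen f (n + 1) (liftExp f n g) (m + 1))
      (liftFn f n F) s := by
  obtain ⟨P, hP, rfl⟩ := hF
  refine ⟨P.map (liftFnStage g m (m + 1) (liftIdx_le_succ m)),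
    lt_of_le_of_lt Polynomial.natDegree_map_le hP, ?_⟩
  rw [liftFn_eval_map g m (m + 1) (liftIdx_le_succ m), liftFn_chainGen_of_le g hm]

/-- Elements of `M_m` lift into `M̃_{m+1}` (a convenient weakening of `liftFn_mem_chain`).
[folklore] -/
theorem liftFn_mem_chain_succ (g : ℕ → termFnRing f n) {m : ℕ} {F : termFnRing f n}
    (hF : F ∈ chain f n g m) : liftFn f n F ∈ chain f (n + 1) (liftExp f n g) (m + 1) :=
  chain_mono f (n + 1) _ (liftIdx_le_succ m) (liftFn_mem_chain g hF)

/-- The new coordinate function `xₙ₊₁` lies in stage `n + 1` of the lifted chain, hence in every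
later stage. [folklore] -/
theorem coordFn_last_mem_chain (g : ℕ → termFnRing f n) {m : ℕ} (hm : n + 1 ≤ m) :
    coordFn f (n + 1) (Fin.last n) ∈ chain f (n + 1) (liftExp f n g) m := by
  have := coordFn_mem_chain f (n + 1) (liftExp f n g) (Fin.last n)
  simp only [Fin.val_last] at this
  exact chain_mono f (n + 1) _ hm this

end Chain

end RealExpModel

end Literature.ModelTheory.ExponentialFields
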